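import Mathlib
import Summits.HodgeConjecture.FermatCycles.HodgeFermatThmFstarStatement

/-!
# THEOREM F*(3N) at every admissible squarefree level `3N` — the STATEMENT (count-neutral)

Cell `pub-hfermat` (tree path `Summits/HodgeConjecture/FermatCycles/`), seat prover-1 gen-2, acting on the
COORDINATOR KEEPER RULING of 2026-08-25 (gem sweep H1: take the off-gate kernel theorem `thmFstar` through the
normal gate, statement first).  The sibling package `run/shared/lean/pub/pub-hodgefermat/lean/HodgeFermat/` has TWO
unconditional kernel theorems named `thmFstar`: `DecodingFinal.thmFstar` (THEOREM F* at the prime levels `3p`,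
GATE HF-G32) — through the gate since 2026-08-25 (`HodgeFermatThmFstarStatement.lean`, `HodgeFermatThmFstar.lean`,
seat prover-1 gen-0) — and `ThmFstarNFinal.thmFstar` (module `HodgeFermat/ThmFstarNFinal.lean:29`, 48 lines, sha256
`bcff3e9353883faa…`; THEOREM F*(3N) at every admissible squarefree level, `pub-hodgefermat/CERT.md` l.987, GATE HF-G33;
cell records `check/ThmFstarN_standalone.lean` — 21 bodies, 438 871 B, sha256 `ced731ec52c92191…`, hub `lean check`
rc 0, `--axioms …ThmFstarN.thmFstarN` = [propext, Classical.choice, Quot.sound] — with `check/BadVanish_standalone.lean`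
`7a70017f76acb2eb…`, `check/HypVRange_standalone.lean` `caff011e51091ee1…`, `check/HypVTail_standalone.lean`
`17a27ced9ca48a43…`), never put through the gate.  This file files the STATEMENT of the second one, as a `Prop`-valued
definition and nothing else; the proof (the import closure of `ThmFstarNFinal.thmFstar` on top of the landed chain
`HodgeFermatLemmaNA` … `HodgeFermatDecodingC`, `HodgeFermatHurwitzZeroB`: the sibling modules `DecodingRing`,
`LemmaEGood`, `HypVDefs`, `BadVanish`, `HypUDefs`, `HypUCert`, `HypUAuto`, `HypVCert`, `HypVRange`, `HypVTail`,
`ThmFstarN`, `ThmFstarNFinal`) follows in the files `HodgeFermat*.lean` of this directory, declaration bodies verbatim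
from the sibling modules, ending in `theorem HodgeFermat.KRFree.ThmFstarNFinal.thmFstarN_holds : ThmFstarN`.

THE STATEMENT (`tables/DPRIME-THEOREM.md` §9 of pub-hodgefermat, THEOREM F* at the level `3N`).  Let `N ≥ 11`,
`N ≠ 13` be SQUAREFREE with all prime factors `≥ 11` (equivalently: squarefree and prime to `210`), and let
`T = (a, b, c)`, `T′ = (a′, b′, c′)` be triples of natural numbers with `a + b + c ≡ a′ + b′ + c′ ≡ 0 (mod 3N)`, all six
entries prime to `N`, and DISJOINT mod `3N` (no entry of `T` is congruent to an entry of `T′`).  Then `T` and `T′` do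
not have the same CM type at level `3N`: `H_T ∩ (ℤ/3N)ˣ ≠ H_{T′} ∩ (ℤ/3N)ˣ`, where `H_T = {t : ⟨ta⟩ + ⟨tb⟩ < 3N}`
(`⟨·⟩` = least non-negative residue mod `3N`) — the model `HodgeFermat.KRFree.LemmaN.SameType` filed with the
prime-level statement (`HodgeFermatThmFstarStatement.lean`, verbatim the sibling's `LemmaN.lean` l.60–69), imported
here, not re-declared.  The prime case `N = p` is THEOREM F* at the prime levels (`DecodingFinal.ThmFstar`); for
composite `N` (then `N ≥ 121`) the sibling's proof kills the "bad" coefficients by an uncertainty principle on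
`(ℤ/N)ˣ` under the inequality `12 + 12 Σ_{q ∣ N} φ(N/q)/ord_{N/q}(q) < φ(N)` (HYPOTHESIS V, certified for every
squarefree `N ≥ 25` prime to `210` by a kernel walk up to `30000` and a tail argument).  `N = 13` is a genuine
exception (the level-39 pair `(1, 16, 22) ∼ (2, 5, 32)`), whence `N ≠ 13`.  Context: for the Fermat varieties of
degree `m = 3N` the CM type of the triple `(a, b, c)` is the set `H_T ∩ (ℤ/m)ˣ` (Koblitz–Rohrlich 1978); THEOREM
F*(3N) is the decoding step of the sibling's analysis of the Hodge gap groups `G_{3N}` (DOOR.md §0 of this cell; no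
claim on general Hodge is made or implied here).

HONEST FRAMING: explicit algebraic cycles for specific Hodge classes on Fermat/Delsarte varieties; residual open
instances listed; no claim on general Hodge.  No `sorry`; one `Prop`-valued definition (count-neutral).
-/

set_option autoImplicit false

namespace HodgeFermat.KRFree.ThmFstarNFinal

open HodgeFermat.KRFree.LemmaN

/-- **THEOREM F\*(3N) at every admissible squarefree level — the statement.**  For every squarefree `N ≥ 11`,
`N ≠ 13` all of whose prime factors are `≥ 11`, and all zero-sum triples `(a, b, c)`, `(a′, b′, c′)` mod `3N` with
all entries prime to `N` that are DISJOINT mod `3N` (no entry of the first congruent to an entry of the second), the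
two triples do not have the same CM type at level `3N` (`LemmaN.SameType (3N)`).  This is LITERALLY the universal
closure of the signature of the sibling package's `HodgeFermat.KRFree.ThmFstarNFinal.thmFstar`
(`ThmFstarNFinal.lean:29`); proved in `HodgeFermatThmFstarN.lean` as `thmFstarN_holds`.
(pub-hodgefermat `tables/DPRIME-THEOREM.md` §9; CERT.md l.987, GATE HF-G33.) -/
def ThmFstarN : Prop :=
  ∀ ⦃N : ℕ⦄, 11 ≤ N → N ≠ 13 → Squarefree N → (∀ p ∈ N.primeFactors, 11 ≤ p) → ∀ ⦃a b c a' b' c' : ℕ⦄,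
    3 * N ∣ a + b + c → 3 * N ∣ a' + b' + c' →
    Nat.Coprime a N → Nat.Coprime b N → Nat.Coprime c N →
    Nat.Coprime a' N → Nat.Coprime b' N → Nat.Coprime c' N →
    (∀ u v, (u = a ∨ u = b ∨ u = c) → (v = a' ∨ v = b' ∨ v = c') → ¬ u ≡ v [MOD 3 * N]) →
    ¬ SameType (3 * N) (a, b, c) (a', b', c')

end HodgeFermat.KRFree.ThmFstarNFinal
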